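import Literature.MathematicalPhysics.QuantumFieldTheory.Balaban1983to89.T4Hk163StripRate
import Literature.MathematicalPhysics.QuantumFieldTheory.Balaban1983to89.B5Hk163TorusHolderRate
import Literature.MathematicalPhysics.QuantumFieldTheory.Balaban1983to89.Beta.FluctuationProjection
import Summits.QuantumFields.BalabanUV.T4Continuum.Support.BalabanAveragedTowerModes

/-!
# `BalabanUV.Beta.GAN24.HkKingOneStep` — binder row G-an2-4 ∕ (CONV-C), route R7: THE ONE-STEP LAW OF BAŁABAN'S VECTOR MINIMISER
# `H_k` (B5 (1.63)) AT `U = 1` AGAINST KING'S BLOCK-PARENT MAP, IN KERNEL CURRENCY (decay × rate `η¹`) AND IN `sup → sup` CURRENCY —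
# every torus, volume-uniform, constants functions of `d` alone; an ASSEMBLY BY NAME of the NE2 lane's strip rate
# `T4Hk163StripRate.torusKernel_G163_rate` with b05's kernel dictionary and gradient-kernel decay

NOT IN PRINT; OUR PROOF ATTEMPT (prover part P3 of row G-an2-4, fibre∕strip («Woodbury») lineage, gen 27; CRUX TEAM (2), ruling «YM
REDIRECT TOWARDS THE SUMMIT», 2026-08-21).  HONEST DEPENDENCY (cell records, verbatim): «continuum YM on T⁴ ⇐ BetaPertH ∧ nine spine
estimates (0/9 proved); BetaPertH ⇐ (D1) ∧ (D4) ∧ CAP+tail; G-an2-4 gates asym, D1 and NE2/3/4.»  HONEST FRAMING (cell contract, verbatim):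
«discharging `BetaPertH` makes Bałaban's UV stability UNCONDITIONAL — a real constructive-QFT result; it is NOT the continuum limit and NOT
the Clay problem.»  ABSOLUTE RULE: nothing printed is a hypothesis; no `def … : Prop`, no sorry; [folklore] assembly over TREE objects BY NAME.

## The item

`beta/ROUTES-GAN24.md` v10 §2 «R7 (u) R7-OPEN-AND-NOBODY'S»: «(V-HALF) ≡ p3's INTERFACE REQUEST G-an2-4 (R7-HCONS) in sup form … no file
yet», and the located reading shared by leaf-04 g50 (INTENT 3 (iii)), idea-1 g9 ([IDEA1-G9-ADDENDUM]) and p2 g30 (INBOX l.8642): «(R7-HCONS) in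
operator form ⟺ the sup → sup one-step rate of Bałaban's HARD minimiser `H_k = 𝒢Q*(Q𝒢Q*)⁻¹` on bounded unit-lattice fields = the `H_k`
constituent of (CONV-C) ITSELF».  THIS FILE proves that one-step rate, in the currency the consumer socket uses — KING's block-parent map
`x′ ↦ x` («When x′ ∈ T_{η′}, we denote by x that point in T_η for which x′ ∈ B^n(x)», [King1986] p. 664) — and in KERNEL currency with the
exponential decay, i.e. in the literal two-clause shape of the row's (CONV-C) for the constituent `H` at `U = 1`.

## The mechanism (three tree theorems, by name)

Write a fine point of level `n` as `n·y′ + a` (`B5Block118.bpt n M y′ a`, unit point `y′`, offset `a ∈ {0..n−1}^{d+1}`).  b05's dictionary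
(`B5Hk163Torus.hker_bpt` + `gker_toT_eq_torusKernel`): the entry `H_n((n·y′+a, μ), (y, λ))` IS the torus kernel at `y′ − y` of the
fine-offset multiplier `G^{(n)}_a = Σ_l e^{i(p′+l)·a∕n} h_{l;μλ}` (`B5Hk163Decay.G163`) — §1.  Two levels `n ≤ m` at the SAME PHYSICAL OFFSET
(`a′·n = a·m`): the NE2 lane's `T4Hk163StripRate.torusKernel_G163_rate` (t4-ne2-p2 gen 5; King's §4 «successively replace each factor»
mechanism run on the complex zero-free strip, then b04's contour-shift engine) gives `CGe(d+1)∕n · periodConst · e^{−(κ₁₆₃∕(d+1))|y′−y|_T}` — §2.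
KING's PARENT of the level-`RN` point `RN·y′ + a′` is the level-`N` point `N·y′ + ⌊a′∕R⌋` (`HkKingOneStepSup.par_bpt`), which is NOT at the same physical
position: the level-`RN` point at the parent's position is `RN·y′ + R⌊a′∕R⌋`, at most `R − 1` fine steps per direction away, INSIDE the same
block.  One fine step moves an `H_n` entry by `n⁻¹ ×` the GRADIENT kernel `dker` (`B5Hk163TorusHolder`), which decays with `d`-only constants
(`B5Hk163TorusHolderDecay.norm_dker_bpt_le`, `MD163`) — §3; so the displacement costs `(d+1)(R−1)∕(RN)·MD163·periodConst·e^{−κ…} ≤ (d+1)·MD163∕N·…`.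
Sum: §4 **`norm_HkOp_king_sub_le`** `‖H_{RN}((RN·y′+a′,μ),(y,λ)) − H_N((N·y′+⌊a′∕R⌋,μ),(y,λ))‖ ≤ KH1(d)∕N · e^{−(κ₁₆₃(d+1)∕(d+1))|y′−y|_T}`,
`KH1 := (CGe + (d+1)·MD163)·periodConst` — with `B5Hk163Torus.norm_HkOp_le` (the `k`-uniform decay) this is the constituent `H` of (CONV-C) at
`U = 1` in BOTH clauses, rate `θ = L⁻¹` along `N = L^k`, EVERY torus, volume-uniform (`hk_king_two_clauses`).  The row sums, the
`sup → sup` law on bounded unit fields and the reading at an ARBITRARY fine point against `BalabanAveragedTowerModes.par` (the currency of the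
lineage's `parT` sockets) are in the companion `HkKingOneStepSup`.

WHY THIS IS NOT the staircase residual: leaf-04 g50's `SoftColumnTwoLevel` ∕ p2 g30's located `RT′∂′ᴴ(J⊗1)𝒢Q*` concern the COMPONENTWISE
STAIRCASE injection, whose gauge defect `Π′D` is real (idea-1 (ρ2-P)); King's block-parent map is averaging-compatible (idea-1 R7 v10 (t4) «the
injection decides») and the (1.63) fibre route pays the in-block displacement with the gradient kernel instead of a gauge letter.

HONEST SCOPE.  [folklore] assembly BY NAME; `U = 1`; rate `η¹` (`θ = L⁻¹`; the half-spacing phases of (1.63) are first order — no `L⁻²` is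
claimed for `H_k`); constants ours, crude, `d`-only; NOT (CONV-C) as a whole (the S1 chain list, the unit letters `Γ_u`∕`C^{(k)}` at general `U`,
(ρ5), S7 remain), NEVER «G-an2-4 closed», NOT NE2, NOT D1, NOT BetaPertH, NOT continuum, NOT Clay.  Locators (text only):
[Balaban1984PropagatorsI] (1.63) p. 28, p. 29 (properties of `H_kB`), p. 38 (analyticity method); [King1986] p. 664 (the pairing `x′ ↦ x`),
Prop. 3.8 (3.71) p. 664, §4 pp. 672–673 (mechanism).  Provenance: prover-b2b-balaban-gan24-p3-g27-0 (unit `b2b-balaban-gan24-p3`, gen 27), 2026-08-21.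
-/

noncomputable section

open scoped BigOperators ComplexConjugate Matrix
open Finset

namespace Summit.QuantumFields.BalabanUV.Beta.GAN24.HkKingOneStep

open Literature.MathematicalPhysics.QuantumFieldTheory.Balaban1983to89
open Literature.MathematicalPhysics.QuantumFieldTheory.Balaban1983to89.B5Prop11Plancherel (Tor fine unitVec)
open Literature.MathematicalPhysics.QuantumFieldTheory.Balaban1983to89.B4TorusKernel (descendC periodConst)
open Literature.MathematicalPhysics.QuantumFieldTheory.Balaban1983to89.B4TorusKernel.MultiPeriod (torusKernel torusSupNorm)
open Literature.MathematicalPhysics.QuantumFieldTheory.Balaban1983to89.B4Sect5Proof (latticeConst latticeConst_nonneg)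
open Literature.MathematicalPhysics.QuantumFieldTheory.Balaban1983to89.B5Block118 (bpt tstep tstep_succ)
open Literature.MathematicalPhysics.QuantumFieldTheory.Balaban1983to89.B5Blocks16 (blockOf bpt_val)
open Literature.MathematicalPhysics.QuantumFieldTheory.Balaban1983to89.B5Kernel166Decay (toT_sub periodConst_pos)
open Literature.MathematicalPhysics.QuantumFieldTheory.Balaban1983to89.B6LowerBound2153Torus (toT rep toT_rep)
open Literature.MathematicalPhysics.QuantumFieldTheory.Balaban1983to89.B6Cov2156Torus (one_le_M)
open Literature.MathematicalPhysics.QuantumFieldTheory.Balaban1983to89.B5Hk163Strip (kappa163 kappa163_pos)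
open Literature.MathematicalPhysics.QuantumFieldTheory.Balaban1983to89.B5Hk163Decay (G163 MG163 MG163_nonneg stripRegular_G163)
open Literature.MathematicalPhysics.QuantumFieldTheory.Balaban1983to89.B5Hk163Torus (hker HkOp hker_bpt gker_toT_eq_torusKernel
  norm_HkOp_le)
open Literature.MathematicalPhysics.QuantumFieldTheory.Balaban1983to89.B5Hk163TorusHolder (dker)
open Literature.MathematicalPhysics.QuantumFieldTheory.Balaban1983to89.B5Hk163TorusHolderDecay (MD163 norm_dker_bpt_le CHolder163_nonneg)
open Literature.MathematicalPhysics.QuantumFieldTheory.Balaban1983to89.B5Hk163TorusHolderRate (sum_exp_torusSupNorm_sub_rep_le)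
open Literature.MathematicalPhysics.QuantumFieldTheory.Balaban1983to89.T4Hk163StripRate (CGe CGe_nonneg torusKernel_G163_rate)
open Literature.MathematicalPhysics.QuantumFieldTheory.Balaban1983to89.Beta.FluctuationProjection (digitOf bpt_blockOf_digitOf
  bpt_add_tstep_of_lt)
open Summit.QuantumFields.BalabanUV.T4Continuum.BalabanAveragedTowerModes (par val_par)

variable {d : ℕ}

/-! ## §0 The constants (functions of `d` alone) -/

/-- the decay rate `κ₁₆₃(d+1)∕(d+1)` shared by b05's kernel bounds for `H_k` and `∂_νH_k`. OURS. [folklore] -/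
def dec (d : ℕ) : ℝ := kappa163 (d + 1) / (d + 1)

/-- `0 < dec d`. [folklore] -/
theorem dec_pos (d : ℕ) : 0 < dec d := div_pos (kappa163_pos _) (by positivity)

/-- the one-step displacement constant `MD163(d+1)·periodConst` (one fine step of an `H_k` entry, times `n`). OURS. [folklore] -/
def KHd (d : ℕ) : ℝ := MD163 (d + 1) * periodConst (kappa163 (d + 1)) d

/-- `0 ≤ KHd d`. [folklore] -/
theorem KHd_nonneg (d : ℕ) : 0 ≤ KHd d := by
  have hC : 0 ≤ B5Hk163Holder.CHolder163 (d + 1) 0 := CHolder163_nonneg (0 : Fin (d + 1)) le_rfl zero_lt_one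
  have h1 : 0 ≤ MD163 (d + 1) := by unfold MD163; positivity
  have h2 := (periodConst_pos (kappa163_pos (d + 1)) d).le
  unfold KHd; exact mul_nonneg h1 h2

/-- **the one-step constant of `H_k` against King's parent map**: `KH1 d := (CGe(d+1) + (d+1)·MD163(d+1))·periodConst(κ₁₆₃(d+1), d)`.
OURS, crude, `d` only. [folklore] -/
def KH1 (d : ℕ) : ℝ := (CGe (d + 1) + (d + 1) * MD163 (d + 1)) * periodConst (kappa163 (d + 1)) d

/-- `0 ≤ KH1 d`. [folklore] -/
theorem KH1_nonneg (d : ℕ) : 0 ≤ KH1 d := by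
  have hC : 0 ≤ B5Hk163Holder.CHolder163 (d + 1) 0 := CHolder163_nonneg (0 : Fin (d + 1)) le_rfl zero_lt_one
  have h1 : 0 ≤ MD163 (d + 1) := by unfold MD163; positivity
  have h2 := (periodConst_pos (kappa163_pos (d + 1)) d).le
  have h3 := CGe_nonneg (d + 1)
  unfold KH1; positivity

/-! ## §1 The entries of the typed `H_k` ARE the torus kernels of the fine-offset multipliers `G_a` -/

section Kernel

variable (n : ℕ) [NeZero n] (M : Fin (d + 1) → ℕ) [hM : ∀ μ, NeZero (M μ)]

/-- **b05's dictionary, read at the entry**: `H_n((n·ȳ′ + a, μ), (ȳ, λ)) = torusKernel (G^{(n)}_{a;μλ}) M (y′ − y)` for lattice representatives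
`y′, y ∈ ℤ^{d+1}` (`B5Hk163Torus.hker_bpt` + `gker_toT_eq_torusKernel`). [cite: Balaban1984PropagatorsI, (1.63) p.28] [folklore] -/
theorem HkOp_bpt_toT_eq (μ lam : Fin (d + 1)) (a : Fin (d + 1) → Fin n) (x' x : Fin (d + 1) → ℤ) :
    HkOp n M (bpt n M (toT M x') a, μ) (toT M x, lam)
      = torusKernel (descendC (fun p : Fin (d + 1) → ℂ => G163 n μ lam a p)
          (stripRegular_G163 n (kappa163_pos _).le le_rfl μ lam a) (kappa163_pos _).le) M (x' - x) := by
  show hker n M μ lam (bpt n M (toT M x') a) (toT M x) = _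
  rw [hker_bpt, toT_sub, gker_toT_eq_torusKernel]

/-- the `k`-uniform decay clause, restated with this file's constants: `‖H_n((n·ȳ′+a,μ),(ȳ,λ))‖ ≤ MG163(d+1)·periodConst·e^{−dec·|y′−y|_T}`
(`B5Hk163Torus.norm_HkOp_le` BY NAME). [folklore] -/
theorem norm_HkOp_bpt_le (μ lam : Fin (d + 1)) (a : Fin (d + 1) → Fin n) (x' x : Fin (d + 1) → ℤ) :
    ‖HkOp n M (bpt n M (toT M x') a, μ) (toT M x, lam)‖
      ≤ MG163 (d + 1) * periodConst (kappa163 (d + 1)) d * Real.exp (-(dec d * torusSupNorm M (x' - x))) :=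
  norm_HkOp_le n M μ lam a x' x

end Kernel

/-! ## §2 Two levels at the SAME physical fine offset: the NE2 lane's strip rate, read at the entries -/

section SamePhys

variable {n m : ℕ} [NeZero n] [NeZero m] (M : Fin (d + 1) → ℕ) [hM : ∀ μ, NeZero (M μ)]

/-- **two levels `n ≤ m`, same physical offset (`a′·n = a·m`)**:
`‖H_m((m·ȳ′+a′,μ),(ȳ,λ)) − H_n((n·ȳ′+a,μ),(ȳ,λ))‖ ≤ CGe(d+1)∕n · periodConst · e^{−dec·|y′−y|_T}` — `T4Hk163StripRate.torusKernel_G163_rate`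
BY NAME through §1. [folklore] -/
theorem norm_HkOp_sub_samePhys_le (hn : 1 ≤ n) (hnm : n ≤ m) (μ lam : Fin (d + 1)) (a : Fin (d + 1) → Fin n)
    (a' : Fin (d + 1) → Fin m) (hphys : ∀ ν, (a' ν : ℕ) * n = (a ν : ℕ) * m) (x' x : Fin (d + 1) → ℤ) :
    ‖HkOp m M (bpt m M (toT M x') a', μ) (toT M x, lam) - HkOp n M (bpt n M (toT M x') a, μ) (toT M x, lam)‖
      ≤ CGe (d + 1) / n * periodConst (kappa163 (d + 1)) d * Real.exp (-(dec d * torusSupNorm M (x' - x))) := by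
  rw [HkOp_bpt_toT_eq, HkOp_bpt_toT_eq]
  exact torusKernel_G163_rate hn hnm μ lam a a' hphys (one_le_M M) (x' - x)

end SamePhys

/-! ## §3 Displacement inside the block: each fine step costs `n⁻¹ ×` the gradient-kernel bound -/

section Displacement

variable (n : ℕ) [NeZero n] (M : Fin (d + 1) → ℕ) [hM : ∀ μ, NeZero (M μ)]

/-- **one fine step in direction `ν`**: `‖hker((n·ȳ′+a) + e_ν, ȳ) − hker(n·ȳ′+a, ȳ)‖ ≤ n⁻¹·KHd(d)·e^{−dec·|y′−y|_T}` — the difference IS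
`n⁻¹·dker` (`B5Hk163TorusHolder.dker`), bounded by `B5Hk163TorusHolderDecay.norm_dker_bpt_le`. [folklore] -/
theorem norm_hker_add_unitVec_sub_le (μ lam ν : Fin (d + 1)) (a : Fin (d + 1) → Fin n) (x' x : Fin (d + 1) → ℤ) :
    ‖hker n M μ lam (bpt n M (toT M x') a + unitVec (fine n M) ν) (toT M x) - hker n M μ lam (bpt n M (toT M x') a) (toT M x)‖
      ≤ (n : ℝ)⁻¹ * (KHd d * Real.exp (-(dec d * torusSupNorm M (x' - x)))) := by
  have hn : (0 : ℝ) < n := by exact_mod_cast Nat.pos_of_ne_zero (NeZero.ne n)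
  have h := norm_dker_bpt_le n M μ lam ν a x' x
  rw [dker, norm_mul, Complex.norm_natCast] at h
  rw [KHd, dec]
  calc ‖hker n M μ lam (bpt n M (toT M x') a + unitVec (fine n M) ν) (toT M x) - hker n M μ lam (bpt n M (toT M x') a) (toT M x)‖
      = (n : ℝ)⁻¹ * ((n : ℝ) *
          ‖hker n M μ lam (bpt n M (toT M x') a + unitVec (fine n M) ν) (toT M x) - hker n M μ lam (bpt n M (toT M x') a) (toT M x)‖) := by
        rw [← mul_assoc, inv_mul_cancel₀ hn.ne', one_mul]
    _ ≤ (n : ℝ)⁻¹ * (MD163 (d + 1) * periodConst (kappa163 (d + 1)) d *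
          Real.exp (-(kappa163 (d + 1) / (d + 1) * torusSupNorm M (x' - x)))) :=
        mul_le_mul_of_nonneg_left h (inv_nonneg.mpr hn.le)

/-- **`t` fine steps in direction `ν` inside the block** (`c_ν + t < n`): the entry moves by `≤ t·n⁻¹·KHd(d)·e^{−dec·|y′−y|_T}`
(`Beta.FluctuationProjection.bpt_add_tstep_of_lt` + §3 one step, `t` times). [folklore] -/
theorem norm_hker_bpt_update_sub_le (μ lam ν : Fin (d + 1)) (x' x : Fin (d + 1) → ℤ) (c : Fin (d + 1) → Fin n) (t : ℕ)
    (ht : (c ν : ℕ) + t < n) :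
    ‖hker n M μ lam (bpt n M (toT M x') (Function.update c ν ⟨(c ν : ℕ) + t, ht⟩)) (toT M x)
        - hker n M μ lam (bpt n M (toT M x') c) (toT M x)‖
      ≤ t * ((n : ℝ)⁻¹ * (KHd d * Real.exp (-(dec d * torusSupNorm M (x' - x))))) := by
  induction t with
  | zero =>
    have e : (⟨(c ν : ℕ) + 0, ht⟩ : Fin n) = c ν := Fin.ext (by simp)
    rw [e, Function.update_eq_self, sub_self, norm_zero, Nat.cast_zero, zero_mul]
  | succ t ih =>
    have ht' : (c ν : ℕ) + t < n := by omega
    have e : bpt n M (toT M x') (Function.update c ν ⟨(c ν : ℕ) + (t + 1), ht⟩)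
        = bpt n M (toT M x') (Function.update c ν ⟨(c ν : ℕ) + t, ht'⟩) + unitVec (fine n M) ν := by
      rw [← bpt_add_tstep_of_lt n M (toT M x') c ν (t + 1) ht, ← bpt_add_tstep_of_lt n M (toT M x') c ν t ht', tstep_succ,
        add_assoc]
    rw [e]
    have h1 := norm_hker_add_unitVec_sub_le n M μ lam ν (Function.update c ν ⟨(c ν : ℕ) + t, ht'⟩) x' x
    calc _ ≤ ‖hker n M μ lam (bpt n M (toT M x') (Function.update c ν ⟨(c ν : ℕ) + t, ht'⟩) + unitVec (fine n M) ν) (toT M x)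
              - hker n M μ lam (bpt n M (toT M x') (Function.update c ν ⟨(c ν : ℕ) + t, ht'⟩)) (toT M x)‖
            + ‖hker n M μ lam (bpt n M (toT M x') (Function.update c ν ⟨(c ν : ℕ) + t, ht'⟩)) (toT M x)
              - hker n M μ lam (bpt n M (toT M x') c) (toT M x)‖ := norm_sub_le_norm_sub_add_norm_sub _ _ _
      _ ≤ (n : ℝ)⁻¹ * (KHd d * Real.exp (-(dec d * torusSupNorm M (x' - x))))
            + t * ((n : ℝ)⁻¹ * (KHd d * Real.exp (-(dec d * torusSupNorm M (x' - x))))) := add_le_add h1 (ih ht')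
      _ = ((t + 1 : ℕ) : ℝ) * ((n : ℝ)⁻¹ * (KHd d * Real.exp (-(dec d * torusSupNorm M (x' - x))))) := by
          push_cast; ring

/-- the offset vector that agrees with `a′` on the directions in `s` and with `c` elsewhere (bookkeeping for the multi-direction
telescoping). OURS. [folklore] -/
def mix (c a' : Fin (d + 1) → Fin n) (s : Finset (Fin (d + 1))) : Fin (d + 1) → Fin n :=
  fun ν => if ν ∈ s then a' ν else c ν

omit [NeZero n] in
/-- `mix c a′ ∅ = c`. [folklore] -/
theorem mix_empty (c a' : Fin (d + 1) → Fin n) : mix n c a' ∅ = c := by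
  funext ν; simp [mix]

omit [NeZero n] in
/-- `mix c a′ univ = a′`. [folklore] -/
theorem mix_univ (c a' : Fin (d + 1) → Fin n) : mix n c a' Finset.univ = a' := by
  funext ν; simp [mix]

omit [NeZero n] in
/-- inserting a direction `ν ∉ s` into `s` is an update of `mix c a′ s` at `ν` by `a′_ν − c_ν` steps (`c_ν ≤ a′_ν`). [folklore] -/
theorem mix_insert (c a' : Fin (d + 1) → Fin n) (hle : ∀ ν, (c ν : ℕ) ≤ a' ν) {s : Finset (Fin (d + 1))} {ν : Fin (d + 1)}
    (hν : ν ∉ s) (ht : ((mix n c a' s) ν : ℕ) + ((a' ν : ℕ) - (c ν : ℕ)) < n) :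
    Function.update (mix n c a' s) ν ⟨((mix n c a' s) ν : ℕ) + ((a' ν : ℕ) - (c ν : ℕ)), ht⟩ = mix n c a' (insert ν s) := by
  funext ν'
  by_cases h : ν' = ν
  · subst h
    rw [Function.update_self]
    apply Fin.ext
    have hm : mix n c a' s ν' = c ν' := by simp [mix, hν]
    show (mix n c a' s ν' : ℕ) + ((a' ν' : ℕ) - (c ν' : ℕ)) = (mix n c a' (insert ν' s) ν' : ℕ)
    have hm' : mix n c a' (insert ν' s) ν' = a' ν' := by simp [mix]
    rw [hm, hm']
    have := hle ν'
    omega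
  · rw [Function.update_of_ne h]
    simp [mix, Finset.mem_insert, h]

/-- **monotone displacement inside the block**: for offsets `c ≤ a′` componentwise, the entry at `n·ȳ′ + a′` differs from the entry at
`n·ȳ′ + c` by `≤ (Σ_ν (a′_ν − c_ν))·n⁻¹·KHd(d)·e^{−dec·|y′−y|_T}` (direction by direction, `Finset.induction`). [folklore] -/
theorem norm_hker_bpt_mono_sub_le (μ lam : Fin (d + 1)) (x' x : Fin (d + 1) → ℤ) (c a' : Fin (d + 1) → Fin n)
    (hle : ∀ ν, (c ν : ℕ) ≤ a' ν) :
    ‖hker n M μ lam (bpt n M (toT M x') a') (toT M x) - hker n M μ lam (bpt n M (toT M x') c) (toT M x)‖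
      ≤ (∑ ν, (((a' ν : ℕ) : ℝ) - ((c ν : ℕ) : ℝ))) * ((n : ℝ)⁻¹ * (KHd d * Real.exp (-(dec d * torusSupNorm M (x' - x))))) := by
  classical
  set E : ℝ := (n : ℝ)⁻¹ * (KHd d * Real.exp (-(dec d * torusSupNorm M (x' - x)))) with hE
  suffices H : ∀ s : Finset (Fin (d + 1)),
      ‖hker n M μ lam (bpt n M (toT M x') (mix n c a' s)) (toT M x) - hker n M μ lam (bpt n M (toT M x') c) (toT M x)‖
        ≤ (∑ ν ∈ s, (((a' ν : ℕ) : ℝ) - ((c ν : ℕ) : ℝ))) * E by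
    have h := H Finset.univ
    rwa [mix_univ] at h
  intro s
  induction s using Finset.induction_on with
  | empty =>
    rw [mix_empty, sub_self, norm_zero, Finset.sum_empty, zero_mul]
  | @insert ν s hν ih =>
    have hm : mix n c a' s ν = c ν := by simp [mix, hν]
    have ht : ((mix n c a' s) ν : ℕ) + ((a' ν : ℕ) - (c ν : ℕ)) < n := by
      rw [hm]; have := hle ν; have := (a' ν).isLt; omega
    have h1 := norm_hker_bpt_update_sub_le n M μ lam ν x' x (mix n c a' s) ((a' ν : ℕ) - (c ν : ℕ)) ht
    rw [mix_insert n c a' hle hν ht] at h1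
    have hcast : (((a' ν : ℕ) - (c ν : ℕ) : ℕ) : ℝ) = ((a' ν : ℕ) : ℝ) - ((c ν : ℕ) : ℝ) := Nat.cast_sub (hle ν)
    rw [hcast] at h1
    rw [Finset.sum_insert hν, add_mul]
    calc _ ≤ ‖hker n M μ lam (bpt n M (toT M x') (mix n c a' (insert ν s))) (toT M x)
              - hker n M μ lam (bpt n M (toT M x') (mix n c a' s)) (toT M x)‖
            + ‖hker n M μ lam (bpt n M (toT M x') (mix n c a' s)) (toT M x) - hker n M μ lam (bpt n M (toT M x') c) (toT M x)‖ :=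
          norm_sub_le_norm_sub_add_norm_sub _ _ _
      _ ≤ _ := add_le_add h1 ih

end Displacement

/-! ## §4 THE ONE-STEP LAW AGAINST KING's PARENT MAP, kernel currency -/

section King

variable {N R : ℕ} [NeZero N] [NeZero R] (M : Fin (d + 1) → ℕ) [hM : ∀ μ, NeZero (M μ)]

omit [NeZero N] in
/-- the level-`RN` offset at the parent's physical position: `R·a`. [folklore] -/
theorem mul_lt_of_lt (a : Fin (d + 1) → Fin N) (ν : Fin (d + 1)) : R * (a ν : ℕ) < R * N :=
  Nat.mul_lt_mul_of_pos_left (a ν).isLt (Nat.pos_of_ne_zero (NeZero.ne R))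

/-- **THE `H_k` ONE-STEP LAW AT `U = 1` AGAINST KING's BLOCK-PARENT MAP, KERNEL CURRENCY, EVERY TORUS**: for `N, R ≥ 1`, unit points
`ȳ′, ȳ`, components `μ, λ`, a level-`RN` offset `a′` and its parent offset `a = ⌊a′∕R⌋`:
`‖H_{RN}((RN·ȳ′+a′, μ), (ȳ, λ)) − H_N((N·ȳ′+a, μ), (ȳ, λ))‖ ≤ KH1(d)∕N · e^{−dec(d)·|y′−y|_T}`.  With `norm_HkOp_bpt_le` (uniform decay) this is
the constituent `H` of the row's (CONV-C) at `U = 1` in both clauses, volume-uniform, constants `d`-only.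
[cite: King1986, p.664 («When x′ ∈ T_{η′}, we denote by x that point in T_η for which x′ ∈ B^n(x)»), Prop. 3.8 (3.71) p.664 (scalar template);
Balaban1984PropagatorsI, (1.63) p.28] [folklore] -/
theorem norm_HkOp_king_sub_le (μ lam : Fin (d + 1)) (x' x : Fin (d + 1) → ℤ) (a : Fin (d + 1) → Fin N)
    (a' : Fin (d + 1) → Fin (R * N)) (hpar : ∀ ν, (a' ν : ℕ) / R = (a ν : ℕ)) :
    ‖HkOp (R * N) M (bpt (R * N) M (toT M x') a', μ) (toT M x, lam) - HkOp N M (bpt N M (toT M x') a, μ) (toT M x, lam)‖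
      ≤ KH1 d / N * Real.exp (-(dec d * torusSupNorm M (x' - x))) := by
  have hN : 1 ≤ N := Nat.pos_of_ne_zero (NeZero.ne N)
  have hR : 1 ≤ R := Nat.pos_of_ne_zero (NeZero.ne R)
  have hN0 : (0 : ℝ) < N := by exact_mod_cast hN
  have hR0 : (0 : ℝ) < R := by exact_mod_cast hR
  have hRN : N ≤ R * N := Nat.le_mul_of_pos_left N hR
  set E : ℝ := Real.exp (-(dec d * torusSupNorm M (x' - x))) with hE
  have hE0 : 0 ≤ E := (Real.exp_pos _).le
  -- the level-`RN` offset at the parent's physical position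
  set a'' : Fin (d + 1) → Fin (R * N) := fun ν => ⟨R * (a ν : ℕ), mul_lt_of_lt a ν⟩ with ha''
  have hphys : ∀ ν, (a'' ν : ℕ) * N = (a ν : ℕ) * (R * N) := fun ν => by
    simp only [ha'', Fin.val_mk]; ring
  have hle : ∀ ν, (a'' ν : ℕ) ≤ a' ν := fun ν => by
    show R * (a ν : ℕ) ≤ a' ν
    rw [← hpar ν]; exact Nat.mul_div_le (a' ν) R
  -- (i) same physical position: the strip rate
  have h1 : ‖HkOp (R * N) M (bpt (R * N) M (toT M x') a'', μ) (toT M x, lam) - HkOp N M (bpt N M (toT M x') a, μ) (toT M x, lam)‖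
      ≤ CGe (d + 1) / N * periodConst (kappa163 (d + 1)) d * E :=
    norm_HkOp_sub_samePhys_le M hN hRN μ lam a a'' hphys x' x
  -- (ii) the displacement inside the block
  have h2 : ‖HkOp (R * N) M (bpt (R * N) M (toT M x') a', μ) (toT M x, lam)
        - HkOp (R * N) M (bpt (R * N) M (toT M x') a'', μ) (toT M x, lam)‖
      ≤ (∑ ν, (((a' ν : ℕ) : ℝ) - ((a'' ν : ℕ) : ℝ))) * ((((R * N : ℕ) : ℝ))⁻¹ * (KHd d * E)) :=
    norm_hker_bpt_mono_sub_le (R * N) M μ lam x' x a'' a' hle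
  -- the displacement is at most `R − 1` steps per direction
  have hstep : ∀ ν, ((a' ν : ℕ) : ℝ) - ((a'' ν : ℕ) : ℝ) ≤ (R : ℝ) - 1 := fun ν => by
    have hmod : (a' ν : ℕ) - (a'' ν : ℕ) = (a' ν : ℕ) % R := by
      show (a' ν : ℕ) - R * (a ν : ℕ) = (a' ν : ℕ) % R
      rw [← hpar ν, Nat.sub_eq_of_eq_add (Nat.mod_add_div (a' ν : ℕ) R).symm]
    have hlt : (a' ν : ℕ) % R < R := Nat.mod_lt _ hR
    rw [← Nat.cast_sub (hle ν), hmod]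
    have : ((a' ν : ℕ) % R : ℕ) + 1 ≤ R := hlt
    have h' : (((a' ν : ℕ) % R : ℕ) : ℝ) + 1 ≤ R := by exact_mod_cast this
    linarith
  have hsum : ∑ ν, (((a' ν : ℕ) : ℝ) - ((a'' ν : ℕ) : ℝ)) ≤ (d + 1) * ((R : ℝ) - 1) := by
    calc ∑ ν, (((a' ν : ℕ) : ℝ) - ((a'' ν : ℕ) : ℝ)) ≤ ∑ _ν : Fin (d + 1), ((R : ℝ) - 1) := Finset.sum_le_sum fun ν _ => hstep ν
      _ = (d + 1) * ((R : ℝ) - 1) := by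
          simp only [Finset.sum_const, Finset.card_univ, Fintype.card_fin, nsmul_eq_mul]; push_cast; ring
  have hK := KHd_nonneg d
  have h2' : ‖HkOp (R * N) M (bpt (R * N) M (toT M x') a', μ) (toT M x, lam)
        - HkOp (R * N) M (bpt (R * N) M (toT M x') a'', μ) (toT M x, lam)‖ ≤ (d + 1) * MD163 (d + 1) * periodConst (kappa163 (d + 1)) d / N * E := by
    refine h2.trans ?_
    have hRN0 : (0 : ℝ) < ((R * N : ℕ) : ℝ) := by push_cast; positivity
    have hT0 : 0 ≤ (((R * N : ℕ) : ℝ))⁻¹ * (KHd d * E) := by positivity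
    calc (∑ ν, (((a' ν : ℕ) : ℝ) - ((a'' ν : ℕ) : ℝ))) * ((((R * N : ℕ) : ℝ))⁻¹ * (KHd d * E))
        ≤ ((d + 1) * ((R : ℝ) - 1)) * ((((R * N : ℕ) : ℝ))⁻¹ * (KHd d * E)) := mul_le_mul_of_nonneg_right hsum hT0
      _ = (d + 1) * KHd d * (((R : ℝ) - 1) / (R * N)) * E := by push_cast; ring
      _ ≤ (d + 1) * KHd d * (1 / N) * E := by
          have hfrac : ((R : ℝ) - 1) / (R * N) ≤ 1 / N := by
            rw [div_le_div_iff₀ (by positivity) hN0]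
            nlinarith
          have h0 : 0 ≤ (d + 1 : ℝ) * KHd d := by positivity
          exact mul_le_mul_of_nonneg_right (mul_le_mul_of_nonneg_left hfrac h0) hE0
      _ = (d + 1) * MD163 (d + 1) * periodConst (kappa163 (d + 1)) d / N * E := by rw [KHd]; ring
  calc _ ≤ ‖HkOp (R * N) M (bpt (R * N) M (toT M x') a', μ) (toT M x, lam)
              - HkOp (R * N) M (bpt (R * N) M (toT M x') a'', μ) (toT M x, lam)‖
          + ‖HkOp (R * N) M (bpt (R * N) M (toT M x') a'', μ) (toT M x, lam) - HkOp N M (bpt N M (toT M x') a, μ) (toT M x, lam)‖ :=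
        norm_sub_le_norm_sub_add_norm_sub _ _ _
    _ ≤ (d + 1) * MD163 (d + 1) * periodConst (kappa163 (d + 1)) d / N * E + CGe (d + 1) / N * periodConst (kappa163 (d + 1)) d * E :=
        add_le_add h2' h1
    _ = KH1 d / N * E := by rw [KH1]; ring

/-- **BOTH CLAUSES of (CONV-C) for the constituent `H` at `U = 1`, King-parent currency, every torus** (packaging of `norm_HkOp_bpt_le` and
`norm_HkOp_king_sub_le`): uniform decay `MG163·periodConst·e^{−dec|y′−y|}` and one-step rate `KH1∕N·e^{−dec|y′−y|}`. [folklore] -/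
theorem hk_king_two_clauses (μ lam : Fin (d + 1)) (x' x : Fin (d + 1) → ℤ) (a : Fin (d + 1) → Fin N)
    (a' : Fin (d + 1) → Fin (R * N)) (hpar : ∀ ν, (a' ν : ℕ) / R = (a ν : ℕ)) :
    ‖HkOp N M (bpt N M (toT M x') a, μ) (toT M x, lam)‖
        ≤ MG163 (d + 1) * periodConst (kappa163 (d + 1)) d * Real.exp (-(dec d * torusSupNorm M (x' - x))) ∧
      ‖HkOp (R * N) M (bpt (R * N) M (toT M x') a', μ) (toT M x, lam) - HkOp N M (bpt N M (toT M x') a, μ) (toT M x, lam)‖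
        ≤ KH1 d / N * Real.exp (-(dec d * torusSupNorm M (x' - x))) :=
  ⟨norm_HkOp_bpt_le N M μ lam a x' x, norm_HkOp_king_sub_le M μ lam x' x a a' hpar⟩

end King

end Summit.QuantumFields.BalabanUV.Beta.GAN24.HkKingOneStep

end
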